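import Mathlib.Analysis.Calculus.ContDiff.Defs
import HarnessLib

/-!
# Word expansion of a (continuous) multilinear map on a common linear combination

Topic `Analysis/Calculus`; namespace `Literature.Analysis.Calculus`.  THEOREMS ONLY (no `def`, no
instance, no notation, no axiom, no named fact, no `sorry`); Mathlib-only imports.

The «CHOICE EXPANSION» interface (`stub_choice`) of the formal step (B1) of the in-house
Glaeser–Chevalley road for `S₃` (cell `pub/hodgecm-mathlib`, N8-census §5 (9); binder LH7-p01
(g6), this file F0P3a-p09 (g9)): for a multilinear map `A` in `d` arguments of a common module `X`,
`A(∑ᵢ ξᵢ bᵢ, …, ∑ᵢ ξᵢ bᵢ) = ∑_{w : Fin d → Fin n} (∏ₖ ξ_{w k}) • A(b_{w 0}, …, b_{w (d-1)})`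
— in particular for the `d`-th Fréchet derivative `A = Dᵈ f(p)`, whose diagonal values are the
Taylor forms of `f`.  Pure multilinearity: Mathlib's `map_sum` (expansion over choice functions)
followed by `map_smul_univ`.

* `MultilinearMap.apply_sum_smul_eq_sum_prod_smul`, `ContinuousMultilinearMap.apply_sum_smul_eq_sum_prod_smul`
  — the word expansion for an arbitrary finite index type of summands and of arguments;
* `iteratedFDeriv_apply_sum_smul_eq_sum_prod_smul` — the head (`stub_choice` token for token).

## References

* [Dieudonne1960] J. Dieudonné, *Foundations of Modern Analysis* (1960), Ch. VIII §12, (8.12.1)–(8.12.4)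
  (higher derivatives as symmetric multilinear maps; their values on repeated linear combinations
  expand multilinearly).
-/

open Finset

namespace Literature.Analysis.Calculus

/-- **Word expansion of a multilinear map on a common linear combination.**  For a multilinear map
`A` in arguments indexed by a finite type `κ`, all in the same module `X`, scalars `ξᵢ` and vectors
`bᵢ` indexed by a finite type `ι`:
`A (fun _ => ∑ᵢ ξᵢ • bᵢ) = ∑_{w : κ → ι} (∏ₖ ξ (w k)) • A (fun k => b (w k))`.
[cite: Dieudonne1960, Ch. VIII §12 (8.12.1)] -/
theorem MultilinearMap.apply_sum_smul_eq_sum_prod_smul {R : Type*} [CommSemiring R] {κ ι : Type*}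
    [Fintype κ] [DecidableEq κ] [Fintype ι] {X Y : Type*} [AddCommMonoid X] [Module R X]
    [AddCommMonoid Y] [Module R Y] (A : MultilinearMap R (fun _ : κ => X) Y) (ξ : ι → R)
    (b : ι → X) :
    A (fun _ => ∑ i, ξ i • b i) = ∑ w : κ → ι, (∏ k, ξ (w k)) • A (fun k => b (w k)) := by
  rw [A.map_sum (fun (_ : κ) (i : ι) => ξ i • b i)]
  exact sum_congr rfl fun w _ => A.map_smul_univ (fun k => ξ (w k)) (fun k => b (w k))

/-- **Word expansion of a continuous multilinear map on a common linear combination.**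
[cite: Dieudonne1960, Ch. VIII §12 (8.12.1)] -/
theorem ContinuousMultilinearMap.apply_sum_smul_eq_sum_prod_smul {R : Type*} [CommSemiring R]
    {κ ι : Type*} [Fintype κ] [DecidableEq κ] [Fintype ι] {X Y : Type*} [AddCommMonoid X]
    [Module R X] [TopologicalSpace X] [AddCommMonoid Y] [Module R Y] [TopologicalSpace Y]
    (A : ContinuousMultilinearMap R (fun _ : κ => X) Y) (ξ : ι → R) (b : ι → X) :
    A (fun _ => ∑ i, ξ i • b i) = ∑ w : κ → ι, (∏ k, ξ (w k)) • A (fun k => b (w k)) :=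
  MultilinearMap.apply_sum_smul_eq_sum_prod_smul A.toMultilinearMap ξ b

/-- **Choice expansion of the iterated Fréchet derivative** (the binder's `stub_choice`, token for
token): the `d`-th derivative of `f` at `p` evaluated on the constant tuple `∑ᵢ ξᵢ • bᵢ` expands as
the sum over words `w : Fin d → Fin n` of `(∏ₖ ξ_{w k}) • Dᵈf(p)(b_{w 0}, …, b_{w (d-1)})`.
[cite: Dieudonne1960, Ch. VIII §12 (8.12.4)] -/
theorem iteratedFDeriv_apply_sum_smul_eq_sum_prod_smul {X : Type*} [NormedAddCommGroup X]
    [NormedSpace ℝ X] {F' : Type*} [NormedAddCommGroup F'] [NormedSpace ℝ F'] {n d : ℕ}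
    (f : X → F') (p : X) (ξ : Fin n → ℝ) (b : Fin n → X) :
    iteratedFDeriv ℝ d f p (fun _ => ∑ i, ξ i • b i) =
      ∑ w : Fin d → Fin n, (∏ k, ξ (w k)) • iteratedFDeriv ℝ d f p (fun k => b (w k)) :=
  ContinuousMultilinearMap.apply_sum_smul_eq_sum_prod_smul (iteratedFDeriv ℝ d f p) ξ b

/-- The same for the derivative within a set. [cite: Dieudonne1960, Ch. VIII §12 (8.12.4)] -/
theorem iteratedFDerivWithin_apply_sum_smul_eq_sum_prod_smul {X : Type*} [NormedAddCommGroup X]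
    [NormedSpace ℝ X] {F' : Type*} [NormedAddCommGroup F'] [NormedSpace ℝ F'] {n d : ℕ}
    (f : X → F') (s : Set X) (p : X) (ξ : Fin n → ℝ) (b : Fin n → X) :
    iteratedFDerivWithin ℝ d f s p (fun _ => ∑ i, ξ i • b i) =
      ∑ w : Fin d → Fin n, (∏ k, ξ (w k)) • iteratedFDerivWithin ℝ d f s p (fun k => b (w k)) :=
  ContinuousMultilinearMap.apply_sum_smul_eq_sum_prod_smul (iteratedFDerivWithin ℝ d f s p) ξ b

end Literature.Analysis.Calculus
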